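/-
Fleet lead `ym-wcr-19609-p1` (seat prover-ym-wcr-19609-p1-g2-0), route `WeakCouplingRates`, crux `BulkDominatesColdBoxW`
(stmt-QuantumFields-19609), line `dlr-chessboard` (v8): A-cov assembly — the bookkeeping parameters as monomials `C·(2H+3)^k·β^a`.
-/
import Summits.QuantumFields.YangMills.Theorems.WeakCouplingRatesBulkDominatesColdBoxWKernelCovDatumCore
import Summits.QuantumFields.YangMills.Theorems.WeakCouplingRatesEventuallyPow
import Summits.QuantumFields.YangMills.Theorems.WeakCouplingRatesColdBoxExponents
import Literature.MathematicalPhysics.QuantumFieldTheory.Balaban1983to89.B9Eq376POneLetters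
import Literature.Analysis.FluidPDE.TaoSingleScaleGeometry

/-!
# Crux `BulkDominatesColdBoxW`, stub `stub_kernelCovExpansion`: monomial bounds for the bookkeeping parameters of the A-cov core with datum

The deterministic core `abs_kernelCov_sub_gaussian_le_datum` (`…KernelCovDatumCore`) is instantiated with the CONCRETE parameters delivered by the
datum package (`exists_datum_package_eventually`: datum size `r² = 2·278400²·β^{6θ+2δ−1}`, energy `B = 16(2H+3)⁴β^{2δ−1}`), the YM rarity
`pY = e^{−β^ε}`, the Gaussian threshold `R = 2β^{ε/2}` and the T4 link bound `m = √2(12H²+2H+1)(√(β^{2ε−1}) + 8r)`.  This file bounds every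
resulting quantity by a monomial `C·X^k·β^a` (`X = 2H+3`, `β ≥ 1`), so that the stub file only has to invoke the generic eventual-smallness lemmas
of `…EventuallyPow` (`C·(2⌈β^θ⌉+3)^k·β^a ≤ β^b` eventually when `kθ + a < b`):
`r ≤ 4·10⁵β^{3θ+δ−1/2}`, `√(2β)r ≤ 6·10⁵β^{3θ+δ}`, `√(2βB) ≤ 6X²β^δ`, `R' ≤ 2400006·X²β^{3θ+δ}`, `m ≤ 14400005·X²β^{ε−1/2}`, the tilt size
`w ≤ 43440·cm³X¹⁰β^{3ε−1/2} + 8cm²X⁸β^{2ε−1}`, the Gaussian bad mass `P ≤ 720X⁴e^{−β^ε}`, `√P ≤ 27X²e^{−β^ε}`, and the sandwich radius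
and windows.  (The combination `abs_kernelCov_sub_gaussian_le_rpow` is the sibling file `…KernelCovDatumRpow`.)
Pure real arithmetic; no sorry; no new definition; standard axioms.  NOT a claim about the mass gap.
-/

set_option autoImplicit false

noncomputable section

open MeasureTheory ProbabilityTheory Finset Real
open Literature.Probability.LatticeModels (Site)
open Literature.MathematicalPhysics.QuantumLattice
open Literature.MathematicalPhysics.QuantumFieldTheory
open Literature.MathematicalPhysics.QuantumFieldTheory.LatticeMaxwell
open Literature.MathematicalPhysics.QuantumFieldTheory.AxialGauge

namespace Summit.QuantumFields.YangMills.Theorems.WeakCouplingRates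

/-! ## `rpow` algebra at `β ≥ 1` -/

/-- `(β^a)^n = β^{n a}`. -/
theorem rpow_pow_eq_rpow {β : ℝ} (hβ : 0 ≤ β) (a : ℝ) (n : ℕ) : (β ^ a) ^ n = β ^ ((n : ℝ) * a) := by
  rw [← Real.rpow_natCast, ← Real.rpow_mul hβ, mul_comm]

/-- `√(β^a) = β^{a/2}` for `β ≥ 0`. -/
theorem sqrt_rpow_eq_rpow_half {β : ℝ} (hβ : 0 ≤ β) (a : ℝ) : Real.sqrt (β ^ a) = β ^ (a / 2) := by
  rw [Real.sqrt_eq_rpow, ← Real.rpow_mul hβ]; ring_nf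

/-- `√(2β) = √2 · β^{1/2}`. -/
theorem sqrt_two_mul_eq_sqrt_two_mul_rpow {β : ℝ} (hβ : 0 ≤ β) : Real.sqrt (2 * β) = Real.sqrt 2 * β ^ (1 / 2 : ℝ) := by
  rw [Real.sqrt_mul' _ hβ, Real.sqrt_eq_rpow β]

/-! ## The datum size `r` -/

/-- **The datum size**: `r = √(2·278400²·β^{6θ+2δ−1})` is `≥ 0`, squares to the package's bound, and `r ≤ 4·10⁵·β^{3θ+δ−1/2}`. -/
theorem datum_r_bounds {β θ δ : ℝ} (hβ : 0 < β) :
    0 ≤ Real.sqrt (2 * 278400 ^ 2 * β ^ (6 * θ + 2 * δ - 1)) ∧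
      Real.sqrt (2 * 278400 ^ 2 * β ^ (6 * θ + 2 * δ - 1)) ^ 2 = 2 * 278400 ^ 2 * β ^ (6 * θ + 2 * δ - 1) ∧
      Real.sqrt (2 * 278400 ^ 2 * β ^ (6 * θ + 2 * δ - 1)) ≤ 400000 * β ^ (3 * θ + δ - 1 / 2) := by
  have h0 : 0 ≤ 2 * 278400 ^ 2 * β ^ (6 * θ + 2 * δ - 1) := by positivity
  refine ⟨Real.sqrt_nonneg _, Real.sq_sqrt h0, ?_⟩
  have hc : 0 ≤ 400000 * β ^ (3 * θ + δ - 1 / 2) := by positivity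
  have hsq : (400000 * β ^ (3 * θ + δ - 1 / 2)) ^ 2 = 160000000000 * β ^ (6 * θ + 2 * δ - 1) := by
    rw [mul_pow, rpow_pow_eq_rpow hβ.le]; norm_num; ring_nf
  calc Real.sqrt (2 * 278400 ^ 2 * β ^ (6 * θ + 2 * δ - 1)) ≤ Real.sqrt ((400000 * β ^ (3 * θ + δ - 1 / 2)) ^ 2) := by
        refine Real.sqrt_le_sqrt ?_
        rw [hsq]
        have : 0 ≤ β ^ (6 * θ + 2 * δ - 1) := Real.rpow_nonneg hβ.le _
        nlinarith
    _ = 400000 * β ^ (3 * θ + δ - 1 / 2) := Real.sqrt_sq hc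

/-- `√(2β)·r ≤ 6·10⁵·β^{3θ+δ}`. -/
theorem sqrt_two_beta_mul_datum_r_le {β θ δ : ℝ} (hβ : 0 < β) :
    Real.sqrt (2 * β) * Real.sqrt (2 * 278400 ^ 2 * β ^ (6 * θ + 2 * δ - 1)) ≤ 600000 * β ^ (3 * θ + δ) := by
  obtain ⟨-, -, hr⟩ := datum_r_bounds (θ := θ) (δ := δ) hβ
  have hs0 : 0 ≤ Real.sqrt (2 * β) := Real.sqrt_nonneg _
  have hprod : β ^ (1 / 2 : ℝ) * β ^ (3 * θ + δ - 1 / 2) = β ^ (3 * θ + δ) := by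
    rw [← Real.rpow_add hβ]; ring_nf
  have hpos : 0 ≤ β ^ (3 * θ + δ) := Real.rpow_nonneg hβ.le _
  calc Real.sqrt (2 * β) * Real.sqrt (2 * 278400 ^ 2 * β ^ (6 * θ + 2 * δ - 1))
      ≤ Real.sqrt (2 * β) * (400000 * β ^ (3 * θ + δ - 1 / 2)) := mul_le_mul_of_nonneg_left hr hs0
    _ = 400000 * Real.sqrt 2 * (β ^ (1 / 2 : ℝ) * β ^ (3 * θ + δ - 1 / 2)) := by
        rw [sqrt_two_mul_eq_sqrt_two_mul_rpow hβ.le]; ring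
    _ = 400000 * Real.sqrt 2 * β ^ (3 * θ + δ) := by rw [hprod]
    _ ≤ 400000 * (3 / 2) * β ^ (3 * θ + δ) := by gcongr; exact Literature.Analysis.FluidPDE.Tao2016.sqrt_two_le
    _ = 600000 * β ^ (3 * θ + δ) := by ring

/-! ## The energy bound and the scaled background bound `R'` -/

/-- `√(2β·16X⁴β^{2δ−1}) ≤ 6X²β^δ` (`4√2 ≤ 6`). -/
theorem sqrt_two_beta_energy_le {β δ X : ℝ} (hβ : 0 < β) :
    Real.sqrt (2 * β * (16 * X ^ 4 * β ^ (2 * δ - 1))) ≤ 6 * X ^ 2 * β ^ δ := by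
  have hc : 0 ≤ 6 * X ^ 2 * β ^ δ := by positivity
  have hprod : β * β ^ (2 * δ - 1) = (β ^ δ) ^ 2 := by
    rw [rpow_pow_eq_rpow hβ.le, show β * β ^ (2 * δ - 1) = β ^ (1 : ℝ) * β ^ (2 * δ - 1) by rw [Real.rpow_one],
      ← Real.rpow_add hβ]; push_cast; ring_nf
  have hle : 2 * β * (16 * X ^ 4 * β ^ (2 * δ - 1)) ≤ (6 * X ^ 2 * β ^ δ) ^ 2 := by
    have e : 2 * β * (16 * X ^ 4 * β ^ (2 * δ - 1)) = 32 * X ^ 4 * (β * β ^ (2 * δ - 1)) := by ring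
    rw [e, hprod]
    have : 0 ≤ X ^ 4 * (β ^ δ) ^ 2 := by positivity
    nlinarith
  exact (Real.sqrt_le_sqrt hle).trans_eq (Real.sqrt_sq hc)

/-- **The scaled background bound**: `R' = √(2βB) + 4√(2β)r ≤ 2400006·X²·β^{3θ+δ}` (`X = 2H+3 ≥ 1`, `β ≥ 1`, `θ ≥ 0`). -/
theorem datum_Rprime_le {β θ δ X : ℝ} (hβ : 1 ≤ β) (hθ : 0 ≤ θ) (hX : 1 ≤ X) :
    Real.sqrt (2 * β * (16 * X ^ 4 * β ^ (2 * δ - 1))) +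
        4 * (Real.sqrt (2 * β) * Real.sqrt (2 * 278400 ^ 2 * β ^ (6 * θ + 2 * δ - 1))) ≤
      2400006 * X ^ 2 * β ^ (3 * θ + δ) := by
  have hβ0 : 0 < β := by linarith
  have h1 := sqrt_two_beta_energy_le (δ := δ) (X := X) hβ0
  have h2 := sqrt_two_beta_mul_datum_r_le (θ := θ) (δ := δ) hβ0
  have hmono : β ^ δ ≤ β ^ (3 * θ + δ) := Real.rpow_le_rpow_of_exponent_le hβ (by linarith)
  have hX2 : 1 ≤ X ^ 2 := one_le_pow₀ hX
  have hpos : 0 ≤ β ^ (3 * θ + δ) := Real.rpow_nonneg hβ0.le _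
  have hX2pos : 0 ≤ X ^ 2 := by positivity
  have h3 : 6 * X ^ 2 * β ^ δ ≤ 6 * X ^ 2 * β ^ (3 * θ + δ) := by gcongr
  have h4 : 600000 * β ^ (3 * θ + δ) ≤ 600000 * X ^ 2 * β ^ (3 * θ + δ) := by nlinarith
  linarith

/-! ## The T4 link bound `m` and the tilt size `w` -/

/-- `√(β^{2ε−1}) + 8r ≤ 3200001·β^{ε−1/2}` when `3θ + δ ≤ ε` and `β ≥ 1`. -/
theorem datum_ell_le {β θ δ ε : ℝ} (hβ : 1 ≤ β) (hδε : 3 * θ + δ ≤ ε) :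
    Real.sqrt (β ^ (2 * ε - 1)) + 8 * Real.sqrt (2 * 278400 ^ 2 * β ^ (6 * θ + 2 * δ - 1)) ≤ 3200001 * β ^ (ε - 1 / 2) := by
  have hβ0 : 0 < β := by linarith
  obtain ⟨-, -, hr⟩ := datum_r_bounds (θ := θ) (δ := δ) hβ0
  have hs : Real.sqrt (β ^ (2 * ε - 1)) = β ^ (ε - 1 / 2) := by rw [sqrt_rpow_eq_rpow_half hβ0.le]; ring_nf
  have hmono : β ^ (3 * θ + δ - 1 / 2) ≤ β ^ (ε - 1 / 2) := Real.rpow_le_rpow_of_exponent_le hβ (by linarith)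
  rw [hs]
  linarith

/-- `12H² + 2H + 1 ≤ 3(2H+3)²`. -/
theorem linkPoly_le_three_mul_sq (H : ℕ) : 12 * (H : ℝ) ^ 2 + 2 * H + 1 ≤ 3 * (2 * (H : ℝ) + 3) ^ 2 := by
  have : (0 : ℝ) ≤ H := Nat.cast_nonneg H
  nlinarith

/-- **The T4 link bound as a monomial**: `m = √2(12H²+2H+1)(√(β^{2ε−1}) + 8r) ≤ 14400005·(2H+3)²·β^{ε−1/2}` (`3θ + δ ≤ ε`, `β ≥ 1`). -/
theorem datum_m_le {β θ δ ε : ℝ} {H : ℕ} (hβ : 1 ≤ β) (hδε : 3 * θ + δ ≤ ε) :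
    Real.sqrt 2 * ((12 * (H : ℝ) ^ 2 + 2 * H + 1) *
        (Real.sqrt (β ^ (2 * ε - 1)) + 8 * Real.sqrt (2 * 278400 ^ 2 * β ^ (6 * θ + 2 * δ - 1)))) ≤
      14400005 * (2 * (H : ℝ) + 3) ^ 2 * β ^ (ε - 1 / 2) := by
  have hβ0 : 0 < β := by linarith
  have hℓ := datum_ell_le hβ hδε
  have hA := linkPoly_le_three_mul_sq H
  have hℓ0 : 0 ≤ Real.sqrt (β ^ (2 * ε - 1)) + 8 * Real.sqrt (2 * 278400 ^ 2 * β ^ (6 * θ + 2 * δ - 1)) := by positivity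
  have hA0 : 0 ≤ 12 * (H : ℝ) ^ 2 + 2 * H + 1 := by positivity
  have hpos : 0 ≤ β ^ (ε - 1 / 2) := Real.rpow_nonneg hβ0.le _
  have hX2 : 0 ≤ (2 * (H : ℝ) + 3) ^ 2 := by positivity
  calc Real.sqrt 2 * ((12 * (H : ℝ) ^ 2 + 2 * H + 1) *
        (Real.sqrt (β ^ (2 * ε - 1)) + 8 * Real.sqrt (2 * 278400 ^ 2 * β ^ (6 * θ + 2 * δ - 1))))
      ≤ 3 / 2 * ((3 * (2 * (H : ℝ) + 3) ^ 2) * (3200001 * β ^ (ε - 1 / 2))) := by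
        refine mul_le_mul Literature.Analysis.FluidPDE.Tao2016.sqrt_two_le (mul_le_mul hA hℓ hℓ0 (by positivity)) (by positivity) (by norm_num)
    _ ≤ 14400005 * (2 * (H : ℝ) + 3) ^ 2 * β ^ (ε - 1 / 2) := by nlinarith

/-- `τ = 362βm³ ≤ 362·cm³·X⁶·β^{3ε−1/2}` and `m² ≤ cm²X⁴β^{2ε−1}` for `0 ≤ m ≤ cm·X²·β^{ε−1/2}`. -/
theorem datum_tau_sq_le {β ε m cm X : ℝ} (hβ : 0 < β) (hm0 : 0 ≤ m) (hm : m ≤ cm * X ^ 2 * β ^ (ε - 1 / 2)) :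
    362 * β * m ^ 3 ≤ 362 * cm ^ 3 * X ^ 6 * β ^ (3 * ε - 1 / 2) ∧ m ^ 2 ≤ cm ^ 2 * X ^ 4 * β ^ (2 * ε - 1) := by
  have h3 : m ^ 3 ≤ (cm * X ^ 2 * β ^ (ε - 1 / 2)) ^ 3 := pow_le_pow_left₀ hm0 hm 3
  have h2 : m ^ 2 ≤ (cm * X ^ 2 * β ^ (ε - 1 / 2)) ^ 2 := pow_le_pow_left₀ hm0 hm 2
  have e3 : β * (cm * X ^ 2 * β ^ (ε - 1 / 2)) ^ 3 = cm ^ 3 * X ^ 6 * β ^ (3 * ε - 1 / 2) := by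
    rw [mul_pow, mul_pow, rpow_pow_eq_rpow hβ.le, show β * (cm ^ 3 * (X ^ 2) ^ 3 * β ^ ((3 : ℕ) * (ε - 1 / 2))) =
      cm ^ 3 * (X ^ 2) ^ 3 * (β ^ (1 : ℝ) * β ^ ((3 : ℕ) * (ε - 1 / 2))) by rw [Real.rpow_one]; ring, ← Real.rpow_add hβ]
    push_cast; ring_nf
  have e2 : (cm * X ^ 2 * β ^ (ε - 1 / 2)) ^ 2 = cm ^ 2 * X ^ 4 * β ^ (2 * ε - 1) := by
    rw [mul_pow, mul_pow, rpow_pow_eq_rpow hβ.le]; push_cast; ring_nf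
  refine ⟨?_, h2.trans_eq e2⟩
  calc 362 * β * m ^ 3 ≤ 362 * β * (cm * X ^ 2 * β ^ (ε - 1 / 2)) ^ 3 := by gcongr
    _ = 362 * (β * (cm * X ^ 2 * β ^ (ε - 1 / 2)) ^ 3) := by ring
    _ = 362 * cm ^ 3 * X ^ 6 * β ^ (3 * ε - 1 / 2) := by rw [e3]; ring

/-- The counts: `#(plaquettesTouching Λ) ≤ 120(2H+3)⁴` and `#(ColdFreeIdx H) ≤ 4(2H+3)⁴`. -/
theorem touching_free_counts_le (H : ℕ) :
    (#(plaquettesTouching (boxEdges 4 (2 * H + 1))) : ℝ) ≤ 120 * (2 * (H : ℝ) + 3) ^ 4 ∧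
      (Fintype.card (ColdFreeIdx H) : ℝ) ≤ 4 * (2 * (H : ℝ) + 3) ^ 4 := by
  have hX : (2 * (H : ℝ) + 1) ^ 4 ≤ (2 * (H : ℝ) + 3) ^ 4 :=
    pow_le_pow_left₀ (by positivity) (by linarith) 4
  constructor
  · have h := card_plaquettesTouching_boxEdges_le (2 * H + 1)
    have h' : ((#(plaquettesTouching (boxEdges 4 (2 * H + 1))) : ℕ) : ℝ) ≤ ((120 * (2 * H + 1) ^ 4 : ℕ) : ℝ) := by exact_mod_cast h
    push_cast at h'
    linarith
  · have h1 : Fintype.card (ColdFreeIdx H) ≤ Fintype.card ↥(boxEdges 4 (2 * H + 1)) := Fintype.card_subtype_le _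
    rw [Fintype.card_coe] at h1
    have h2 := card_boxEdges_four_le (2 * H + 1)
    have h' : ((Fintype.card (ColdFreeIdx H) : ℕ) : ℝ) ≤ ((4 * (2 * H + 1) ^ 4 : ℕ) : ℝ) := by exact_mod_cast h1.trans h2
    push_cast at h'
    linarith

/-- **The tilt size as monomials**: `w = #touching·τ + 2·#free·m² ≤ 43440·cm³X¹⁰β^{3ε−1/2} + 8cm²X⁸β^{2ε−1}`. -/
theorem datum_w_le {β ε m cm : ℝ} {H : ℕ} (hβ : 0 < β) (hm0 : 0 ≤ m)
    (hm : m ≤ cm * (2 * (H : ℝ) + 3) ^ 2 * β ^ (ε - 1 / 2)) :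
    (#(plaquettesTouching (boxEdges 4 (2 * H + 1))) : ℝ) * (362 * β * m ^ 3) + 2 * (Fintype.card (ColdFreeIdx H) : ℝ) * m ^ 2 ≤
      43440 * cm ^ 3 * (2 * (H : ℝ) + 3) ^ 10 * β ^ (3 * ε - 1 / 2) + 8 * cm ^ 2 * (2 * (H : ℝ) + 3) ^ 8 * β ^ (2 * ε - 1) := by
  obtain ⟨hτ, hm2⟩ := datum_tau_sq_le hβ hm0 hm
  obtain ⟨hP, hN⟩ := touching_free_counts_le H
  have hτ0 : 0 ≤ 362 * β * m ^ 3 := by positivity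
  have hm20 : 0 ≤ m ^ 2 := sq_nonneg _
  have hX0 : 0 ≤ (2 * (H : ℝ) + 3) := by positivity
  calc (#(plaquettesTouching (boxEdges 4 (2 * H + 1))) : ℝ) * (362 * β * m ^ 3) + 2 * (Fintype.card (ColdFreeIdx H) : ℝ) * m ^ 2
      ≤ 120 * (2 * (H : ℝ) + 3) ^ 4 * (362 * cm ^ 3 * (2 * (H : ℝ) + 3) ^ 6 * β ^ (3 * ε - 1 / 2)) +
          2 * (4 * (2 * (H : ℝ) + 3) ^ 4) * (cm ^ 2 * (2 * (H : ℝ) + 3) ^ 4 * β ^ (2 * ε - 1)) := by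
        gcongr
    _ = _ := by ring

/-! ## The moment constants and the Gaussian threshold -/

/-- With `0 ≤ R' ≤ cR·X²·β^c` (`c ≥ 0`, `X, β ≥ 1`): `6R'²+11 ≤ (6cR²+11)X⁴β^{2c}`, `26R'⁴+261 ≤ 3(6R'²+11)²`, and
`(6R'²+11)² ≤ (6cR²+11)²X⁸β^{4c}`. -/
theorem datum_K_le {β c R' cR X : ℝ} (hβ : 1 ≤ β) (hc : 0 ≤ c) (hX : 1 ≤ X) (hR'0 : 0 ≤ R') (hR' : R' ≤ cR * X ^ 2 * β ^ c) :
    6 * R' ^ 2 + 11 ≤ (6 * cR ^ 2 + 11) * X ^ 4 * β ^ (2 * c) ∧ 26 * R' ^ 4 + 261 ≤ 3 * (6 * R' ^ 2 + 11) ^ 2 ∧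
      (6 * R' ^ 2 + 11) ^ 2 ≤ (6 * cR ^ 2 + 11) ^ 2 * X ^ 8 * β ^ (4 * c) := by
  have hβ0 : 0 < β := by linarith
  have h2 : R' ^ 2 ≤ (cR * X ^ 2 * β ^ c) ^ 2 := pow_le_pow_left₀ hR'0 hR' 2
  have e2 : (cR * X ^ 2 * β ^ c) ^ 2 = cR ^ 2 * X ^ 4 * β ^ (2 * c) := by
    rw [mul_pow, mul_pow, rpow_pow_eq_rpow hβ0.le]; push_cast; ring_nf
  rw [e2] at h2
  have hX4 : 1 ≤ X ^ 4 := one_le_pow₀ hX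
  have hb : 1 ≤ β ^ (2 * c) := Real.one_le_rpow hβ (by linarith)
  have hbX : 1 ≤ X ^ 4 * β ^ (2 * c) := one_le_mul_of_one_le_of_one_le hX4 hb
  have hK1 : 6 * R' ^ 2 + 11 ≤ (6 * cR ^ 2 + 11) * X ^ 4 * β ^ (2 * c) := by nlinarith
  have hK2 : 26 * R' ^ 4 + 261 ≤ 3 * (6 * R' ^ 2 + 11) ^ 2 := by nlinarith [sq_nonneg R', pow_nonneg hR'0 4, sq_nonneg (R' ^ 2)]
  refine ⟨hK1, hK2, ?_⟩
  have h := pow_le_pow_left₀ (by positivity : (0 : ℝ) ≤ 6 * R' ^ 2 + 11) hK1 2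
  have e4 : ((6 * cR ^ 2 + 11) * X ^ 4 * β ^ (2 * c)) ^ 2 = (6 * cR ^ 2 + 11) ^ 2 * X ^ 8 * β ^ (4 * c) := by
    rw [mul_pow, mul_pow, rpow_pow_eq_rpow hβ0.le]; push_cast; ring_nf
  rw [e4] at h
  exact h

/-- **The Gaussian threshold** `R = 2β^{ε/2}`: `R ≥ 0`, `e^{−R²/2} = e^{−2β^ε} ≤ e^{−β^ε}`, so `P = 720(2H+1)⁴e^{−R²/2} ≤ 720X⁴e^{−β^ε}` and
`√P ≤ 27X²e^{−β^ε}`. -/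
theorem datum_P_le {β ε : ℝ} {H : ℕ} (hβ : 0 < β) :
    0 ≤ 2 * β ^ (ε / 2) ∧ (2 * β ^ (ε / 2)) ^ 2 = 4 * β ^ ε ∧
      720 * (2 * (H : ℝ) + 1) ^ 4 * Real.exp (-(2 * β ^ (ε / 2)) ^ 2 / 2) ≤ 720 * (2 * (H : ℝ) + 3) ^ 4 * Real.exp (-(β ^ ε)) ∧
      Real.sqrt (720 * (2 * (H : ℝ) + 1) ^ 4 * Real.exp (-(2 * β ^ (ε / 2)) ^ 2 / 2)) ≤ 27 * (2 * (H : ℝ) + 3) ^ 2 * Real.exp (-(β ^ ε)) := by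
  have hsq : (2 * β ^ (ε / 2)) ^ 2 = 4 * β ^ ε := by
    rw [mul_pow, rpow_pow_eq_rpow hβ.le]; push_cast; ring_nf
  have hexp : Real.exp (-(2 * β ^ (ε / 2)) ^ 2 / 2) = Real.exp (-(β ^ ε)) ^ 2 := by
    rw [hsq, ← Real.exp_nat_mul]; congr 1; push_cast; ring
  have he1 : Real.exp (-(β ^ ε)) ≤ 1 := by
    rw [Real.exp_le_one_iff]; have := Real.rpow_nonneg hβ.le ε; linarith
  have he0 : 0 ≤ Real.exp (-(β ^ ε)) := (Real.exp_pos _).le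
  have hX : (2 * (H : ℝ) + 1) ^ 4 ≤ (2 * (H : ℝ) + 3) ^ 4 := pow_le_pow_left₀ (by positivity) (by linarith) 4
  have hX2 : (2 * (H : ℝ) + 1) ^ 2 ≤ (2 * (H : ℝ) + 3) ^ 2 := pow_le_pow_left₀ (by positivity) (by linarith) 2
  refine ⟨by positivity, hsq, ?_, ?_⟩
  · rw [hexp]
    have hsq1 : Real.exp (-(β ^ ε)) ^ 2 ≤ Real.exp (-(β ^ ε)) := by nlinarith
    calc 720 * (2 * (H : ℝ) + 1) ^ 4 * Real.exp (-(β ^ ε)) ^ 2 ≤ 720 * (2 * (H : ℝ) + 3) ^ 4 * Real.exp (-(β ^ ε)) ^ 2 := by gcongr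
      _ ≤ 720 * (2 * (H : ℝ) + 3) ^ 4 * Real.exp (-(β ^ ε)) := by
          have : 0 ≤ 720 * (2 * (H : ℝ) + 3) ^ 4 := by positivity
          nlinarith
  · rw [hexp]
    have hc : 0 ≤ 27 * (2 * (H : ℝ) + 3) ^ 2 * Real.exp (-(β ^ ε)) := by positivity
    have hle : 720 * (2 * (H : ℝ) + 1) ^ 4 * Real.exp (-(β ^ ε)) ^ 2 ≤ (27 * (2 * (H : ℝ) + 3) ^ 2 * Real.exp (-(β ^ ε))) ^ 2 := by
      have e : (27 * (2 * (H : ℝ) + 3) ^ 2 * Real.exp (-(β ^ ε))) ^ 2 = 729 * (2 * (H : ℝ) + 3) ^ 4 * Real.exp (-(β ^ ε)) ^ 2 := by ring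
      rw [e]
      have : 0 ≤ (2 * (H : ℝ) + 3) ^ 4 * Real.exp (-(β ^ ε)) ^ 2 := by positivity
      nlinarith
    exact (Real.sqrt_le_sqrt hle).trans_eq (Real.sqrt_sq hc)

/-! ## The sandwich radius and windows -/

/-- **The sandwich radius**: with `R = 2β^{ε/2}`, `R' ≤ cR X²β^{3θ+δ}` (`ε/2 ≤ 3θ+δ`), the quantity
`r² + 3((12H²+2H+1)((R+R') + 4√(2β)r))²/(2β)` is `≤ (cs·X⁴·β^{3θ+δ−1/2})²` with `cs = 17650000` (for `cR = 2400006`), and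
`3(R+R')²/(2β) ≤ (3/2)(2+cR)²X⁴β^{6θ+2δ−1}`. -/
theorem datum_sandwich_le {β θ δ ε R' : ℝ} {H : ℕ} (hβ : 1 ≤ β) (hθ : 0 ≤ θ) (hδ : 0 ≤ δ) (hε2 : ε / 2 ≤ 3 * θ + δ)
    (hR'0 : 0 ≤ R') (hR' : R' ≤ 2400006 * (2 * (H : ℝ) + 3) ^ 2 * β ^ (3 * θ + δ)) :
    Real.sqrt (2 * 278400 ^ 2 * β ^ (6 * θ + 2 * δ - 1)) ^ 2 +
        3 * ((12 * (H : ℝ) ^ 2 + 2 * H + 1) * ((2 * β ^ (ε / 2) + R') +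
          4 * (Real.sqrt (2 * β) * Real.sqrt (2 * 278400 ^ 2 * β ^ (6 * θ + 2 * δ - 1))))) ^ 2 / (2 * β) ≤
        (17650000 * (2 * (H : ℝ) + 3) ^ 4 * β ^ (3 * θ + δ - 1 / 2)) ^ 2 ∧
      3 * (2 * β ^ (ε / 2) + R') ^ 2 / (2 * β) ≤ 3 / 2 * 2400008 ^ 2 * (2 * (H : ℝ) + 3) ^ 4 * β ^ (6 * θ + 2 * δ - 1) := by
  have hβ0 : 0 < β := by linarith
  obtain ⟨hr0, hr2, hr⟩ := datum_r_bounds (θ := θ) (δ := δ) hβ0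
  have hsr := sqrt_two_beta_mul_datum_r_le (θ := θ) (δ := δ) hβ0
  have hA := linkPoly_le_three_mul_sq H
  set X : ℝ := 2 * (H : ℝ) + 3 with hXdef
  set c : ℝ := 3 * θ + δ with hcdef
  have hX1 : 1 ≤ X := by rw [hXdef]; have : (0 : ℝ) ≤ H := Nat.cast_nonneg H; linarith
  have hX0 : 0 ≤ X := by linarith
  have hX2 : 1 ≤ X ^ 2 := one_le_pow₀ hX1
  have hc0 : 0 ≤ c := by rw [hcdef]; linarith
  have hβc : 0 ≤ β ^ c := Real.rpow_nonneg hβ0.le _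
  -- `R = 2β^{ε/2} ≤ 2X²β^c`
  have hR : 2 * β ^ (ε / 2) ≤ 2 * X ^ 2 * β ^ c := by
    have h1 : β ^ (ε / 2) ≤ β ^ c := Real.rpow_le_rpow_of_exponent_le hβ hε2
    have h2 : β ^ c ≤ X ^ 2 * β ^ c := le_mul_of_one_le_left hβc hX2
    linarith
  have hRR : 2 * β ^ (ε / 2) + R' ≤ 2400008 * X ^ 2 * β ^ c := by linarith
  have hRR0 : 0 ≤ 2 * β ^ (ε / 2) + R' := by positivity
  -- `ρ ≤ cρ X⁴ β^c`
  have hin : (2 * β ^ (ε / 2) + R') + 4 * (Real.sqrt (2 * β) * Real.sqrt (2 * 278400 ^ 2 * β ^ (6 * θ + 2 * δ - 1))) ≤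
      4800008 * X ^ 2 * β ^ c := by
    have h2 : 600000 * β ^ c ≤ 600000 * X ^ 2 * β ^ c := by nlinarith
    have h4 : 4 * (Real.sqrt (2 * β) * Real.sqrt (2 * 278400 ^ 2 * β ^ (6 * θ + 2 * δ - 1))) ≤ 4 * (600000 * X ^ 2 * β ^ c) :=
      mul_le_mul_of_nonneg_left (hsr.trans h2) (by norm_num)
    exact (add_le_add hRR h4).trans (le_of_eq (by ring))
  have hin0 : 0 ≤ (2 * β ^ (ε / 2) + R') + 4 * (Real.sqrt (2 * β) * Real.sqrt (2 * 278400 ^ 2 * β ^ (6 * θ + 2 * δ - 1))) := by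
    positivity
  have hρ : (12 * (H : ℝ) ^ 2 + 2 * H + 1) * ((2 * β ^ (ε / 2) + R') +
      4 * (Real.sqrt (2 * β) * Real.sqrt (2 * 278400 ^ 2 * β ^ (6 * θ + 2 * δ - 1)))) ≤ 14400024 * X ^ 4 * β ^ c := by
    calc _ ≤ (3 * X ^ 2) * (4800008 * X ^ 2 * β ^ c) := mul_le_mul hA hin hin0 (by positivity)
      _ = 14400024 * X ^ 4 * β ^ c := by ring
  have hρ0 : 0 ≤ (12 * (H : ℝ) ^ 2 + 2 * H + 1) * ((2 * β ^ (ε / 2) + R') +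
      4 * (Real.sqrt (2 * β) * Real.sqrt (2 * 278400 ^ 2 * β ^ (6 * θ + 2 * δ - 1)))) := by positivity
  have hρ2 := pow_le_pow_left₀ hρ0 hρ 2
  -- the algebra `β^{2c}/β = β^{2c−1}`, `(β^{c−1/2})² = β^{2c−1}`
  have e1 : (14400024 * X ^ 4 * β ^ c) ^ 2 / (2 * β) = 14400024 ^ 2 / 2 * X ^ 8 * β ^ (2 * c - 1) := by
    rw [mul_pow, mul_pow, rpow_pow_eq_rpow hβ0.le, show (2 : ℝ) * c - 1 = (2 : ℕ) * c - 1 by push_cast; ring,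
      Real.rpow_sub hβ0, Real.rpow_one]
    field_simp
  have e2 : (17650000 * X ^ 4 * β ^ (3 * θ + δ - 1 / 2)) ^ 2 = 17650000 ^ 2 * X ^ 8 * β ^ (2 * c - 1) := by
    rw [mul_pow, mul_pow, rpow_pow_eq_rpow hβ0.le, hcdef]; push_cast; ring_nf
  have e3 : (2400008 * X ^ 2 * β ^ c) ^ 2 / (2 * β) = 2400008 ^ 2 / 2 * X ^ 4 * β ^ (2 * c - 1) := by
    rw [mul_pow, mul_pow, rpow_pow_eq_rpow hβ0.le, show (2 : ℝ) * c - 1 = (2 : ℕ) * c - 1 by push_cast; ring,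
      Real.rpow_sub hβ0, Real.rpow_one]
    field_simp
  have hr2' : Real.sqrt (2 * 278400 ^ 2 * β ^ (6 * θ + 2 * δ - 1)) ^ 2 ≤ 2 * 278400 ^ 2 * X ^ 8 * β ^ (2 * c - 1) := by
    rw [hr2, show (2 : ℝ) * c - 1 = 6 * θ + 2 * δ - 1 by rw [hcdef]; ring]
    have hX8 : 1 ≤ X ^ 8 := one_le_pow₀ hX1
    have : 0 ≤ β ^ (6 * θ + 2 * δ - 1) := Real.rpow_nonneg hβ0.le _
    nlinarith
  have hpos : 0 ≤ X ^ 8 * β ^ (2 * c - 1) := by positivity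
  have hpos4 : 0 ≤ X ^ 4 * β ^ (2 * c - 1) := by positivity
  constructor
  · have h1 : 3 * ((12 * (H : ℝ) ^ 2 + 2 * H + 1) * ((2 * β ^ (ε / 2) + R') +
          4 * (Real.sqrt (2 * β) * Real.sqrt (2 * 278400 ^ 2 * β ^ (6 * θ + 2 * δ - 1))))) ^ 2 / (2 * β) ≤
        3 * (14400024 ^ 2 / 2 * X ^ 8 * β ^ (2 * c - 1)) := by
      rw [← e1, mul_div_assoc]
      exact mul_le_mul_of_nonneg_left (div_le_div_of_nonneg_right hρ2 (by positivity)) (by norm_num)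
    rw [e2]
    refine (add_le_add hr2' h1).trans ?_
    have hcoef : (2 * 278400 ^ 2 + 3 * (14400024 ^ 2 / 2) : ℝ) ≤ 17650000 ^ 2 := by norm_num
    calc 2 * 278400 ^ 2 * X ^ 8 * β ^ (2 * c - 1) + 3 * (14400024 ^ 2 / 2 * X ^ 8 * β ^ (2 * c - 1))
        = (2 * 278400 ^ 2 + 3 * (14400024 ^ 2 / 2)) * (X ^ 8 * β ^ (2 * c - 1)) := by ring
      _ ≤ 17650000 ^ 2 * (X ^ 8 * β ^ (2 * c - 1)) := mul_le_mul_of_nonneg_right hcoef hpos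
      _ = 17650000 ^ 2 * X ^ 8 * β ^ (2 * c - 1) := by ring
  · have h1 : 3 * (2 * β ^ (ε / 2) + R') ^ 2 / (2 * β) ≤ 3 * (2400008 ^ 2 / 2 * X ^ 4 * β ^ (2 * c - 1)) := by
      rw [← e3, mul_div_assoc]
      exact mul_le_mul_of_nonneg_left (div_le_div_of_nonneg_right (pow_le_pow_left₀ hRR0 hRR 2) (by positivity)) (by norm_num)
    rw [show (6 : ℝ) * θ + 2 * δ - 1 = 2 * c - 1 by rw [hcdef]; ring]
    exact h1.trans (le_of_eq (by ring))

end Summit.QuantumFields.YangMills.Theorems.WeakCouplingRates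

end
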